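import Mathlib.Analysis.SpecificLimits.Normed
import Literature.Barriers.MatrixMultiplication.IrreversibilityBarrier
import Literature.Barriers.MatrixMultiplication.IrreversibilityBarrierProofs
import Literature.Barriers.MatrixMultiplication.UniversalMethodBarrierCwTangent
import Literature.Barriers.MatrixMultiplication.UniversalMethodBarrierProducts
import Literature.Computability.AlgebraicComplexity.FlatteningRank
import HarnessLib

/-!
# Proof of CVZ 2021, Theorem 22: irreversibility of the big Coppersmith–Winograd tensors

Topic `Literature/Barriers/MatrixMultiplication`; PROOF file for the named fact `CVZ2021_thm22` of
`IrreversibilityBarrier.lean` (which vendors the statement and the definitions `bigCwTensor = CW_q`,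
`cvzEntropy q = f_q`, `cvzArgmax q = x_q`). Main result: `CVZ2021_thm22_holds : CVZ2021_thm22`, i.e.
for every field `K` and every `q ≥ 1`,
`2 log₂(q+2) / f_q(x_q) ≤ 2 · i(CW_q)`, `i(t) = ω(⟨2⟩,t) · ω(t,⟨2⟩)` (`irreversibility`,
`relativeExponent` of `RelativeExponent.lean`). Everything here is PROVED (sorry-free).

Source: M. Christandl, P. Vrana, J. Zuiddam, *Barriers for fast matrix multiplication from
irreversibility*, Theory of Computing 17 (2021), art. 2 = arXiv:1812.06952, Thm. 22 and its proof
(arXiv numbering, p. 10 of the held text; §4.1, p. 9, for `Q̃(t) ≤ limsup_n S(t^{⊗n})^{1/n} ≤ ζ^θ(t)`).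

## The printed proof and the formal route

CVZ prove Thm. 22 in two halves (p. 10): (1) every flattening of `CW_q` has rank `q + 2`, hence
`R̃(CW_q) ≥ q + 2`, i.e. `ω(⟨2⟩, CW_q) ≥ log₂(q+2)`; (2) Strassen's upper support functional with
`θ = (1/3,1/3,1/3)` gives `log₂ Q̃(CW_q) ≤ max_P (average marginal entropy) = max_x f_q(x) = f_q(x_q)`,
i.e. `ω(CW_q, ⟨2⟩) ≥ 1/f_q(x_q)`; then `i = ω(⟨2⟩,CW_q) ω(CW_q,⟨2⟩) ≥ log₂(q+2)/f_q(x_q)`. Here: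

* Half (1) is formalised verbatim with the tree's flattening rank `ζ⁽¹⁾` (`FlatteningRank.lean`:
  monotone under restriction, multiplicative on powers; `flatteningRank_bigCwTensor = q + 2` of
  `UniversalMethodBarrierCwCore.lean`): `pow_le_two_pow_of_restrictsTo`
  (`⟨2⟩^{⊗m} ≥ CW_q^{⊗N} ⇒ (q+2)^N ≤ 2^m`) and `logb_le_relativeExponent_unit_bigCw`, directly on
  the infimum defining `relativeExponent` (every defining set is nonempty:
  `unitPow_restrictsTo_cwPow`).
* Half (2) goes through the middle term of CVZ's chain `Q̃ ≤ limsup S(t^{⊗n})^{1/n} ≤ ζ^θ` (§4.1):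
  the finite slice-rank bound for powers of `CW_q` proved in `UniversalMethodBarrierCwCount.lean`
  (`sliceRank_cwPow_le`: `S(CW_q^{⊗m}) ≤ 3(1 + (m+1)³ Bᵐ)` whenever Alman's base `g_q ≤ B` on
  `[0,1/3]`; `g_q(v) = 2^{f_q((1/3−v)/q)}` is the same symmetric-distribution entropy in Alman's
  parametrisation) and Tao's lemma `S(⟨n⟩) = n` (`le_sliceRank_of_restrictsTo_unitTensor`). The
  maximisation "the maximum of `f_q(x)` is attained at `x_q`" is replaced by its DUAL CERTIFICATE
  `cwBase_le_two_rpow_cvzEntropy : g_q ≤ 2^{f_q(x_q)}` — the Gibbs/tangent bound `cwBase_le_tangent`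
  (`UniversalMethodBarrierCwTangent.lean`) at the fixed distribution
  `P* = (2/3 − q x_q, 2q x_q, 1/3 − q x_q)`: the critical-point equation
  `(2x_q)² = (2/3 − q x_q)(1/3 − q x_q)` (`cvzArgmax_spec`, verified for the three printed closed
  forms `q = 1`, `q = 2`, `q ≥ 3`) makes the tangent bound independent of `v`, and
  `f_q(x_q) = −(2/3) log₂(2/3 − q x_q) − (1/3) log₂(1/3 − q x_q)` (`cvzEntropy_argmax_eq`). No
  concavity is needed, and only the direction `f_q ≤ f_q(x_q)` that the theorem uses is proved.
* The polynomial factor is removed by the tensor-power trick (`le_mul_cvzEntropy_of_restrictsTo`: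
  `CW_q^{⊗m} ≥ ⟨2⟩^{⊗n} ⇒ CW_q^{⊗km} ≥ ⟨2^{kn}⟩` for all `k`, and `k³/rᵏ → 0` for `r > 1`,
  `tendsto_pow_const_div_const_pow_of_one_lt`), giving `n ≤ m f_q(x_q)` and
  `inv_cvzEntropy_le_relativeExponent_bigCw_unit` (nonemptiness: `CW_q ≥ ⟨2⟩` for `q ≥ 1`,
  `bigCwTensor_restrictsTo_unitTensor_two`, zeroing out to `e_{0,0,q+1} + e_{1,1,0}`).

## References

* M. Christandl, P. Vrana, J. Zuiddam, Theory of Computing 17 (2021), art. 2, Thm. 22 and §4.1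
  (held: `arxiv-1812.06952`, pp. 9–10). [ChristandlVranaZuiddam2021]
* J. Alman, Theory of Computing 17 (2021), art. 1, Thm. 3.4 / §4.1 (the base `g_q`, as formalised in
  `UniversalMethodBarrierCwCount.lean` / `UniversalMethodBarrierCwTangent.lean`). [Alman2021]
-/

noncomputable section

open scoped BigOperators

namespace Literature.Barriers.MatrixMultiplication

open Literature.Computability.AlgebraicComplexity

universe u

/-! ## Powers of restrictions and of unit tensors -/

section UnitPow

variable {K : Type u} [Field K]

/-- From `t^{⊗m} ≥ s^{⊗n}` to `t^{⊗km} ≥ (s^{⊗n})^{⊗k}`. [folklore] -/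
theorem restrictsTo_pow_mul {ι κ μ ι' κ' μ' : Type*} [Fintype ι] [Fintype κ] [Fintype μ]
    [DecidableEq ι] [DecidableEq κ] [DecidableEq μ] [Fintype ι'] [Fintype κ'] [Fintype μ']
    {t : ι → κ → μ → K} {s : ι' → κ' → μ' → K} {m n : ℕ}
    (h : TensorRestrictsTo (kroneckerPow t m) (kroneckerPow s n)) (k : ℕ) :
    TensorRestrictsTo (kroneckerPow t (k * m)) (kroneckerPow (kroneckerPow s n) k) :=
  (tensorRestrictsTo_kroneckerPow_mul t k m).trans (h.kroneckerPow k)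

/-- `(⟨F⟩^{⊗n})^{⊗k} ≥ ⟨(F^n)^k⟩`. [folklore] -/
theorem unitPowPow_restrictsTo_unitTensor (F n k : ℕ) :
    TensorRestrictsTo (kroneckerPow (kroneckerPow (unitTensor K F) n) k) (unitTensor K ((F ^ n) ^ k)) :=
  ((kroneckerPow_unitTensor_restrictsTo F n).kroneckerPow k).trans
    (kroneckerPow_unitTensor_restrictsTo (F ^ n) k)

end UnitPow

/-! ## The flattening-rank half: `ω(⟨2⟩, CW_q) ≥ log₂ (q+2)` -/

section Flattening

variable {K : Type u} [Field K]

/-- `ζ⁽¹⁾(t) ≤ |X|`. [folklore] -/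
theorem flatteningRank_le_card {ι κ μ : Type*} [Fintype ι] (t : ι → κ → μ → K) :
    flatteningRank t ≤ Fintype.card ι :=
  finrank_range_le_card _

/-- If `⟨2⟩^{⊗m} ≥ CW_q^{⊗N}` then `(q+2)^N ≤ 2^m` (flattening ranks). [cite: ChristandlVranaZuiddam2021, Thm. 22 (proof)] -/
theorem pow_le_two_pow_of_restrictsTo {q m N : ℕ}
    (h : TensorRestrictsTo (kroneckerPow (unitTensor K 2) m) (kroneckerPow (bigCwTensor K q) N)) :
    (q + 2) ^ N ≤ 2 ^ m := by
  have h1 := flatteningRank_mono h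
  rw [flatteningRank_kroneckerPow, flatteningRank_bigCwTensor] at h1
  refine h1.trans ?_
  have h2 := flatteningRank_le_card (kroneckerPow (unitTensor K 2) m)
  simpa [Fintype.card_fun, Fintype.card_fin] using h2

/-- Some power of `⟨2⟩` restricts to `CW_q^{⊗N}` (every tensor is a restriction of a large unit
tensor). [folklore] -/
theorem unitPow_restrictsTo_cwPow (q N : ℕ) :
    TensorRestrictsTo (kroneckerPow (unitTensor K 2) (tensorRank (kroneckerPow (bigCwTensor K q) N)))
      (kroneckerPow (bigCwTensor K q) N) :=
  (kroneckerPow_unitTensor_restrictsTo 2 _).trans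
    ((tensorRestrictsTo_unitTensor_castLE (Nat.lt_two_pow_self).le).trans
      (tensorRestrictsTo_unitTensor_of_tensorRank_le _ le_rfl))

/-- **`log₂ (q+2) ≤ ω(⟨2⟩, CW_q)`** (the asymptotic-rank half of CVZ Thm. 22: every flattening
of `CW_q` has rank `q + 2`). [cite: ChristandlVranaZuiddam2021, Thm. 22 (proof)] -/
theorem logb_le_relativeExponent_unit_bigCw (K : Type u) [Field K] (q : ℕ) :
    Real.logb 2 (q + 2) ≤ relativeExponent (unitTensor K 2) (bigCwTensor K q) := by
  unfold relativeExponent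
  refine le_ciInf fun n => ?_
  have hne : {m : ℕ | TensorRestrictsTo (kroneckerPow (unitTensor K 2) m)
      (kroneckerPow (bigCwTensor K q) (n + 1))}.Nonempty := ⟨_, unitPow_restrictsTo_cwPow q (n + 1)⟩
  have hmem := Nat.sInf_mem hne
  set c := restrictionCost (unitTensor K 2) (bigCwTensor K q) (n + 1) with hc
  have hc' : sInf {m : ℕ | TensorRestrictsTo (kroneckerPow (unitTensor K 2) m)
      (kroneckerPow (bigCwTensor K q) (n + 1))} = c := rfl
  rw [hc'] at hmem
  have hpow := pow_le_two_pow_of_restrictsTo hmem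
  have hreal : ((q : ℝ) + 2) ^ (n + 1) ≤ (2 : ℝ) ^ c := by exact_mod_cast hpow
  have hlog := Real.logb_le_logb_of_le (b := 2) one_lt_two (by positivity) hreal
  rw [Real.logb_pow, Real.logb_pow, Real.logb_self_eq_one one_lt_two, mul_one] at hlog
  rw [le_div_iff₀ (by positivity)]
  push_cast at hlog
  linarith

end Flattening

/-! ## The entropy value `f_q(x_q)` and the dual certificate `g_q ≤ 2^{f_q(x_q)}` -/

section Entropy

/-- **The printed maximiser is the critical point**: for `q ≥ 1`, `x_q = cvzArgmax q` satisfies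
`0 < x_q`, `q x_q < 1/3` and the critical-point equation `(2x_q)² = (2/3 − q x_q)(1/3 − q x_q)` of
`f_q` (equivalently `(q² − 4) x² − q x + 2/9 = 0`). [cite: ChristandlVranaZuiddam2021, Thm. 22 (proof)] -/
theorem cvzArgmax_spec {q : ℕ} (hq : 1 ≤ q) :
    0 < cvzArgmax q ∧ (q : ℝ) * cvzArgmax q < 1 / 3 ∧
      4 * cvzArgmax q ^ 2 = (2 / 3 - q * cvzArgmax q) * (1 / 3 - q * cvzArgmax q) := by
  unfold cvzArgmax
  rcases Nat.lt_or_ge q 3 with hlt | hge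
  · interval_cases q
    · -- q = 1
      simp only [if_true, Nat.cast_one, one_mul]
      have hs : Real.sqrt 33 ^ 2 = 33 := Real.sq_sqrt (by norm_num)
      have hs3 : 3 < Real.sqrt 33 := by
        rw [Real.lt_sqrt (by norm_num)]; norm_num
      have hs9 : Real.sqrt 33 < 9 := by
        rw [Real.sqrt_lt' (by norm_num)]; norm_num
      refine ⟨by linarith, by linarith, ?_⟩
      nlinarith [hs]
    · -- q = 2
      norm_num
  · have h1 : q ≠ 1 := by omega
    have h2 : q ≠ 2 := by omega
    simp only [h1, h2, if_false]
    set s := Real.sqrt (32 + (q : ℝ) ^ 2) with hs_def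
    have hq3 : (3 : ℝ) ≤ q := by exact_mod_cast hge
    have hs2 : s ^ 2 = 32 + (q : ℝ) ^ 2 := Real.sq_sqrt (by positivity)
    have hs0 : 0 ≤ s := Real.sqrt_nonneg _
    have hD : 0 < 6 * ((q : ℝ) ^ 2 - 4) := by nlinarith
    have hs3q : s < 3 * q := by
      rw [hs_def, Real.sqrt_lt' (by positivity)]; nlinarith
    have hqs : (q : ℝ) ^ 2 + 8 < q * s := by
      have h : ((q : ℝ) ^ 2 + 8) / q < s := by
        rw [hs_def, Real.lt_sqrt (by positivity), div_pow, div_lt_iff₀ (by positivity)]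
        nlinarith
      rwa [div_lt_iff₀' (by positivity)] at h
    set y := (3 * (q : ℝ) - s) / (6 * ((q : ℝ) ^ 2 - 4)) with hy_def
    have hq4 : (q : ℝ) ^ 2 - 4 ≠ 0 := by nlinarith
    have hDy : 6 * ((q : ℝ) ^ 2 - 4) * y = 3 * q - s := by
      rw [hy_def]; field_simp
    refine ⟨div_pos (by linarith) hD, ?_, ?_⟩
    · have h : (q : ℝ) * (3 * q - s) < 1 / 3 * (6 * ((q : ℝ) ^ 2 - 4)) := by nlinarith
      calc (q : ℝ) * y = q * (3 * q - s) / (6 * ((q : ℝ) ^ 2 - 4)) := by rw [hy_def]; ring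
        _ < 1 / 3 := by rw [div_lt_iff₀ hD]; exact h
    · have key : 36 * ((q : ℝ) ^ 2 - 4) * (4 * y ^ 2 - (2 / 3 - q * y) * (1 / 3 - q * y)) = 0 := by
        linear_combination (-(6 * ((q : ℝ) ^ 2 - 4) * y - 3 * q - s)) * hDy - hs2
      have hne : 36 * ((q : ℝ) ^ 2 - 4) ≠ 0 := by nlinarith
      have h := (mul_eq_zero.1 key).resolve_left hne
      linarith

/-- At the critical point the entropy `f_q(x_q)` collapses to
`−(2/3) log₂ (2/3 − q x_q) − (1/3) log₂ (1/3 − q x_q)`, and it is positive.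
[cite: ChristandlVranaZuiddam2021, Thm. 22 (proof)] -/
theorem cvzEntropy_argmax_eq {q : ℕ} (hq : 1 ≤ q) :
    cvzEntropy q (cvzArgmax q) =
      -(2 / 3) * Real.logb 2 (2 / 3 - q * cvzArgmax q) - (1 / 3) * Real.logb 2 (1 / 3 - q * cvzArgmax q) := by
  obtain ⟨hx0, hx1, hquad⟩ := cvzArgmax_spec hq
  set x := cvzArgmax q
  have hP0 : 0 < 2 / 3 - (q : ℝ) * x := by linarith
  have hP2 : 0 < 1 / 3 - (q : ℝ) * x := by linarith
  have hlog : Real.logb 2 (2 * x) = (Real.logb 2 (2 / 3 - q * x) + Real.logb 2 (1 / 3 - q * x)) / 2 := by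
    have h4 : (2 * x) ^ 2 = (2 / 3 - q * x) * (1 / 3 - q * x) := by rw [← hquad]; ring
    have := congrArg (Real.logb 2) h4
    rw [Real.logb_pow, Real.logb_mul hP0.ne' hP2.ne'] at this
    push_cast at this
    linarith
  unfold cvzEntropy
  rw [hlog]
  ring

/-- `f_q(x_q) > 0`. [cite: ChristandlVranaZuiddam2021, Thm. 22 (proof)] -/
theorem cvzEntropy_argmax_pos {q : ℕ} (hq : 1 ≤ q) : 0 < cvzEntropy q (cvzArgmax q) := by
  obtain ⟨hx0, hx1, -⟩ := cvzArgmax_spec hq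
  have hq1 : (1 : ℝ) ≤ q := by exact_mod_cast hq
  have hqx : 0 < (q : ℝ) * cvzArgmax q := by positivity
  rw [cvzEntropy_argmax_eq hq]
  have h0 : Real.logb 2 (2 / 3 - q * cvzArgmax q) < 0 := Real.logb_neg one_lt_two (by linarith) (by linarith)
  have h2 : Real.logb 2 (1 / 3 - q * cvzArgmax q) < 0 := Real.logb_neg one_lt_two (by linarith) (by linarith)
  linarith

/-- `2^{f_q(x_q)} = (2/3 − q x_q)^{−2/3} (1/3 − q x_q)^{−1/3}`. [cite: ChristandlVranaZuiddam2021, Thm. 22 (proof)] -/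
theorem two_rpow_cvzEntropy_argmax {q : ℕ} (hq : 1 ≤ q) :
    (2 : ℝ) ^ cvzEntropy q (cvzArgmax q) =
      ((2 / 3 - q * cvzArgmax q) ^ (2 / 3 : ℝ) * (1 / 3 - q * cvzArgmax q) ^ (1 / 3 : ℝ))⁻¹ := by
  obtain ⟨hx0, hx1, -⟩ := cvzArgmax_spec hq
  have hP0 : 0 < 2 / 3 - (q : ℝ) * cvzArgmax q := by linarith
  have hP2 : 0 < 1 / 3 - (q : ℝ) * cvzArgmax q := by linarith
  rw [cvzEntropy_argmax_eq hq, show -(2 / 3) * Real.logb 2 (2 / 3 - q * cvzArgmax q) -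
      (1 / 3) * Real.logb 2 (1 / 3 - q * cvzArgmax q) =
      Real.logb 2 (2 / 3 - q * cvzArgmax q) * (-(2 / 3)) + Real.logb 2 (1 / 3 - q * cvzArgmax q) * (-(1 / 3))
      by ring, Real.rpow_add two_pos, Real.rpow_mul two_pos.le, Real.rpow_mul two_pos.le,
    Real.rpow_logb two_pos (by norm_num) hP0, Real.rpow_logb two_pos (by norm_num) hP2,
    Real.rpow_neg hP0.le, Real.rpow_neg hP2.le, mul_inv]

/-- **`g_q(v) ≤ 2^{f_q(x_q)}` on `[0, 1/3]`** (the Gibbs/tangent bound `cwBase_le_tangent` at the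
distribution `P* = (2/3 − q x_q, 2q x_q, 1/3 − q x_q)`; the critical-point equation makes the bound
independent of `v`). [cite: ChristandlVranaZuiddam2021, Thm. 22 (proof)] -/
theorem cwBase_le_two_rpow_cvzEntropy {q : ℕ} (hq : 1 ≤ q) (v : ℝ) (hv : v ∈ Set.Icc (0 : ℝ) (1 / 3)) :
    cwBase q v ≤ (2 : ℝ) ^ cvzEntropy q (cvzArgmax q) := by
  obtain ⟨hx0, hx1, hquad⟩ := cvzArgmax_spec hq
  set x := cvzArgmax q with hx_def
  have hq0 : (0 : ℝ) < q := by exact_mod_cast hq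
  have hP0 : 0 < 2 / 3 - (q : ℝ) * x := by linarith
  have hP1 : 0 < 2 * (q : ℝ) * x := by positivity
  have hP2 : 0 < 1 / 3 - (q : ℝ) * x := by linarith
  have h := cwBase_le_tangent q hP0 hP1 hP2 (le_of_eq (by ring)) hv
  refine h.trans (le_of_eq ?_)
  rw [two_rpow_cvzEntropy_argmax hq, ← hx_def]
  obtain ⟨hv0, hv1⟩ := hv
  have h2x : 0 ≤ 2 * x := by linarith
  have e0 : (q : ℝ) / (2 * q * x) = 1 / (2 * x) := by
    field_simp
  -- `(2x)^{2/3 - 2v} = (P₀ P₂)^{1/3 - v}` by the critical-point equation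
  have e2 : (2 * x) ^ (2 / 3 - 2 * v) =
      (2 / 3 - (q : ℝ) * x) ^ (1 / 3 - v) * (1 / 3 - (q : ℝ) * x) ^ (1 / 3 - v) := by
    rw [show (2 / 3 - 2 * v) = 2 * (1 / 3 - v) by ring, Real.rpow_mul h2x, Real.rpow_two,
      show (2 * x) ^ 2 = (2 / 3 - (q : ℝ) * x) * (1 / 3 - (q : ℝ) * x) by rw [← hquad]; ring,
      Real.mul_rpow hP0.le hP2.le]
  rw [e0, one_div (2 / 3 - (q : ℝ) * x), one_div (2 * x), one_div (1 / 3 - (q : ℝ) * x),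
    Real.inv_rpow hP0.le, Real.inv_rpow h2x, Real.inv_rpow hP2.le, e2, ← mul_inv, ← mul_inv]
  congr 1
  rw [show (2 / 3 - (q : ℝ) * x) ^ (1 / 3 + v) *
      ((2 / 3 - (q : ℝ) * x) ^ (1 / 3 - v) * (1 / 3 - (q : ℝ) * x) ^ (1 / 3 - v)) *
      (1 / 3 - (q : ℝ) * x) ^ v =
      ((2 / 3 - (q : ℝ) * x) ^ (1 / 3 + v) * (2 / 3 - (q : ℝ) * x) ^ (1 / 3 - v)) *
        ((1 / 3 - (q : ℝ) * x) ^ (1 / 3 - v) * (1 / 3 - (q : ℝ) * x) ^ v) by ring,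
    ← Real.rpow_add hP0, ← Real.rpow_add hP2, show (1 / 3 + v + (1 / 3 - v)) = (2 / 3 : ℝ) by ring,
    show (1 / 3 - v + v) = (1 / 3 : ℝ) by ring]

end Entropy

/-! ## The subrank half: `ω(CW_q, ⟨2⟩) ≥ 1 / f_q(x_q)` -/

section Subrank

variable {K : Type u} [Field K]

/-- `CW_q ≥ ⟨2⟩` for `q ≥ 1` (zero out to `e_{0,0,q+1} + e_{1,1,0}`), so every set defining
`ω(CW_q, ⟨2⟩)` is nonempty. [folklore] -/
theorem bigCwTensor_restrictsTo_unitTensor_two {q : ℕ} (hq : 1 ≤ q) :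
    TensorRestrictsTo (bigCwTensor K q) (unitTensor K 2) := by
  have h2 : 2 ≤ q + 2 := by omega
  have key : unitTensor K 2 = fun a b c => bigCwTensor K q (Fin.castLE h2 a) (Fin.castLE h2 b)
      (if c = 0 then Fin.last (q + 1) else 0) := by
    funext a b c
    rw [unitTensor_apply, bigCwTensor_apply]
    refine if_congr ?_ rfl rfl
    fin_cases a <;> fin_cases b <;> fin_cases c <;>
      simp [Fin.ext_iff] <;> omega
  rw [key]
  exact tensorRestrictsTo_precomp _ _ _ _

/-- **The counting bound without polynomial factors**: if `CW_q^{⊗m} ≥ ⟨2⟩^{⊗n}` then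
`n ≤ m · f_q(x_q)` (apply the finite slice-rank bound `S(CW_q^{⊗km}) ≤ 3(1 + (km+1)³ 2^{km f_q(x_q)})`
to `CW_q^{⊗km} ≥ ⟨2^{kn}⟩` for all `k` and let `k → ∞`). [cite: ChristandlVranaZuiddam2021, Thm. 22 (proof)] -/
theorem le_mul_cvzEntropy_of_restrictsTo {q : ℕ} (hq : 1 ≤ q) {m n : ℕ}
    (h : TensorRestrictsTo (kroneckerPow (bigCwTensor K q) m) (kroneckerPow (unitTensor K 2) n)) :
    (n : ℝ) ≤ m * cvzEntropy q (cvzArgmax q) := by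
  have hBle := cwBase_le_two_rpow_cvzEntropy hq
  have hF := cvzEntropy_argmax_pos hq
  obtain ⟨F, hF_def⟩ : ∃ F, cvzEntropy q (cvzArgmax q) = F := ⟨_, rfl⟩
  rw [hF_def] at hBle hF ⊢
  -- slice rank of all powers
  have hS : ∀ k : ℕ, (2 ^ n) ^ k ≤ sliceRank (kroneckerPow (bigCwTensor K q) (k * m)) := fun k =>
    le_sliceRank_of_restrictsTo_unitTensor
      ((restrictsTo_pow_mul h k).trans (unitPowPow_restrictsTo_unitTensor 2 n k))
  rcases Nat.eq_zero_or_pos m with hm | hm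
  · -- `m = 0`: then `2^n ≤ 1`, so `n = 0`
    subst hm
    have h1 := hS 1
    rw [pow_one, one_mul] at h1
    have hcard := sliceRank_le_card (kroneckerPow (bigCwTensor K q) 0)
    simp only [Fintype.card_fun, Fintype.card_fin, pow_zero] at hcard
    have hn : n = 0 := by
      by_contra hn
      have := Nat.one_lt_two_pow hn
      omega
    subst hn
    simp
  · by_contra hlt
    have hlt' := not_le.1 hlt
    obtain ⟨B, hB_def⟩ : ∃ B, (2 : ℝ) ^ F = B := ⟨_, rfl⟩
    rw [hB_def] at hBle
    have hB1 : 1 ≤ B := by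
      rw [← hB_def]
      simpa using Real.rpow_le_rpow_of_exponent_le one_le_two hF.le
    have hB0 : 0 < B := by linarith
    have hBm : B ^ m < (2 : ℝ) ^ n := by
      rw [← hB_def, ← Real.rpow_mul_natCast two_pos.le, ← Real.rpow_natCast 2 n]
      refine Real.rpow_lt_rpow_of_exponent_lt one_lt_two ?_
      rw [mul_comm]; exact hlt'
    obtain ⟨r, hr_def⟩ : ∃ r, (2 : ℝ) ^ n / B ^ m = r := ⟨_, rfl⟩
    have hr : 1 < r := hr_def ▸ (one_lt_div (by positivity)).2 hBm
    -- the polynomial bound on `r^k`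
    have hbound : ∀ k : ℕ, 1 ≤ k → r ^ k ≤ 6 * ((m : ℝ) + 1) ^ 3 * (k : ℝ) ^ 3 := by
      intro k hk
      have hkm : 0 < k * m := Nat.mul_pos (by omega) hm
      have h1 := sliceRank_cwPow_le (K := K) q (k * m) hkm B hBle
      have h2 : ((2 : ℝ) ^ n) ^ k ≤ (sliceRank (kroneckerPow (bigCwTensor K q) (k * m)) : ℝ) := by
        exact_mod_cast hS k
      have hBkm : 0 < B ^ (k * m) := pow_pos hB0 _
      have h3 : ((2 : ℝ) ^ n) ^ k ≤ 6 * (((k * m : ℕ) : ℝ) + 1) ^ 3 * B ^ (k * m) := by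
        have h1' := h2.trans h1
        have : (1 : ℝ) ≤ (((k * m : ℕ) : ℝ) + 1) ^ 3 * B ^ (k * m) :=
          one_le_mul_of_one_le_of_one_le (one_le_pow₀ (le_add_of_nonneg_left (by positivity)))
            (one_le_pow₀ hB1)
        linarith
      have h4 : r ^ k = ((2 : ℝ) ^ n) ^ k / B ^ (k * m) := by
        rw [← hr_def, div_pow, ← pow_mul B m k, mul_comm m k]
      rw [h4, div_le_iff₀ hBkm]
      refine h3.trans ?_
      have hk1 : (1 : ℝ) ≤ k := by exact_mod_cast hk
      have h5 : (((k * m : ℕ) : ℝ) + 1) ≤ ((m : ℝ) + 1) * k := by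
        push_cast
        nlinarith
      have h6 : (((k * m : ℕ) : ℝ) + 1) ^ 3 ≤ (((m : ℝ) + 1) * k) ^ 3 :=
        pow_le_pow_left₀ (by positivity) h5 3
      calc 6 * (((k * m : ℕ) : ℝ) + 1) ^ 3 * B ^ (k * m)
          ≤ 6 * ((((m : ℝ) + 1) * k) ^ 3) * B ^ (k * m) := by gcongr
        _ = 6 * ((m : ℝ) + 1) ^ 3 * (k : ℝ) ^ 3 * B ^ (k * m) := by ring
    -- but `k^3 / r^k → 0`
    have hlim := tendsto_pow_const_div_const_pow_of_one_lt 3 hr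
    have hc : (0 : ℝ) < 1 / (6 * ((m : ℝ) + 1) ^ 3) := by positivity
    obtain ⟨k, hk1, hk2⟩ := ((Filter.eventually_ge_atTop 1).and (hlim.eventually_lt_const hc)).exists
    have hrk : 0 < r ^ k := pow_pos (by linarith) k
    have hk0 : (0 : ℝ) < k := by exact_mod_cast hk1
    have hb := hbound k hk1
    have h7 : (k : ℝ) ^ 3 < 1 / (6 * ((m : ℝ) + 1) ^ 3) * r ^ k := (div_lt_iff₀ hrk).1 hk2
    have h8 : 1 / (6 * ((m : ℝ) + 1) ^ 3) * r ^ k ≤ (k : ℝ) ^ 3 := by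
      calc 1 / (6 * ((m : ℝ) + 1) ^ 3) * r ^ k
          ≤ 1 / (6 * ((m : ℝ) + 1) ^ 3) * (6 * ((m : ℝ) + 1) ^ 3 * (k : ℝ) ^ 3) :=
            mul_le_mul_of_nonneg_left hb hc.le
        _ = (k : ℝ) ^ 3 := by field_simp
    linarith

/-- **`1 / f_q(x_q) ≤ ω(CW_q, ⟨2⟩)`** (the asymptotic-subrank half of CVZ Thm. 22: in print
`log₂ Q̃(CW_q) ≤ ρ^θ(CW_q) ≤ f_q(x_q)` for the upper support functional with `θ = (1/3,1/3,1/3)`;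
here through the slice rank). [cite: ChristandlVranaZuiddam2021, Thm. 22 (proof)] -/
theorem inv_cvzEntropy_le_relativeExponent_bigCw_unit (K : Type u) [Field K] {q : ℕ} (hq : 1 ≤ q) :
    1 / cvzEntropy q (cvzArgmax q) ≤ relativeExponent (bigCwTensor K q) (unitTensor K 2) := by
  have hF := cvzEntropy_argmax_pos hq
  unfold relativeExponent
  refine le_ciInf fun n => ?_
  have hne : {m : ℕ | TensorRestrictsTo (kroneckerPow (bigCwTensor K q) m)
      (kroneckerPow (unitTensor K 2) (n + 1))}.Nonempty :=
    ⟨n + 1, (bigCwTensor_restrictsTo_unitTensor_two hq).kroneckerPow (n + 1)⟩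
  have hmem := Nat.sInf_mem hne
  set c := restrictionCost (bigCwTensor K q) (unitTensor K 2) (n + 1) with hc
  have hc' : sInf {m : ℕ | TensorRestrictsTo (kroneckerPow (bigCwTensor K q) m)
      (kroneckerPow (unitTensor K 2) (n + 1))} = c := rfl
  rw [hc'] at hmem
  have key := le_mul_cvzEntropy_of_restrictsTo hq hmem
  push_cast at key
  rw [div_le_div_iff₀ hF (by positivity)]
  linarith

end Subrank

/-! ## Assembly -/

section Main

/-- **CVZ 2021, Theorem 22 — proved**: for every field `K` and `q ≥ 1`,
`2 log₂(q+2) / f_q(x_q) ≤ 2 i(CW_q)`. The two factors of `i(CW_q) = ω(⟨2⟩, CW_q) · ω(CW_q, ⟨2⟩)`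
are bounded by `logb_le_relativeExponent_unit_bigCw` (flattening rank `q + 2`) and
`inv_cvzEntropy_le_relativeExponent_bigCw_unit` (slice-rank counting with the dual certificate
`cwBase_le_two_rpow_cvzEntropy`). [cite: ChristandlVranaZuiddam2021, Thm. 22] -/
theorem CVZ2021_thm22_holds : CVZ2021_thm22 := by
  intro K _ q hq
  have hA := logb_le_relativeExponent_unit_bigCw K q
  have hB := inv_cvzEntropy_le_relativeExponent_bigCw_unit K hq
  have hF := cvzEntropy_argmax_pos hq
  have hq0 : (0 : ℝ) ≤ q := Nat.cast_nonneg q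
  have hlog : 0 ≤ Real.logb 2 ((q : ℝ) + 2) := Real.logb_nonneg one_lt_two (by linarith)
  have hmul := mul_le_mul hA hB (by positivity) (relativeExponent_nonneg _ _)
  unfold irreversibility
  calc 2 * Real.logb 2 ((q : ℝ) + 2) / cvzEntropy q (cvzArgmax q)
      = 2 * (Real.logb 2 ((q : ℝ) + 2) * (1 / cvzEntropy q (cvzArgmax q))) := by ring
    _ ≤ 2 * (relativeExponent (unitTensor K 2) (bigCwTensor K q) *
          relativeExponent (bigCwTensor K q) (unitTensor K 2)) := by linarith

end Main

end Literature.Barriers.MatrixMultiplication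

end
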